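import Summits.ABC.StewartYu.ArchG3Sizes
import Summits.ABC.StewartYu.ArchG3Values
import Summits.ABC.StewartYu.ArchG3KStepTaylor
import Summits.ABC.StewartYu.ArchG3KStep
import HarnessLib

/-!
# Cell abc-stewartyu, rung A1.L (crux r2 `ArchCoreRat`), WP-L.A parcel P-A5: the archimedean k-step ON THE Gen-3 CLASS FUNCTIONS,
# Δ-form (the instantiation of `ArchKStep.*_taylor` on `ArchG3Setup.archF`)

`Summits/ABC/StewartYu/ArchG3KStepDelta.lean` — cell `abc-stewartyu` (HOME `run/shared/lean/pub/abc-stewartyu/`; TRANCHE PLAN v1.2 §4′ P-A5;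
rulings R26 (Taylor-normalised k-step of record) and R26(e) (level invariant on Δ-VALUES); seat lp-1 g8).  Theorems on `ArchG3Setup`;
no definition, no named fact.  The archimedean twin of `G3Setup.g3_kstep_pm` (`PadicG3KStepPhi`): from the LEVEL INVARIANT IN Δ-FORM at
the old nodes — `archφ R v B (pvΔ pv c e μ′) (a′, 0) x = 0` for `|x| ≤ N` and `a′ + |μ′| < T` (print (4.6) `Φ_s(x, m) = 0` with the
Fel'dman directional weights (3.34) folded into the integer coefficients `pvΔ`, seat p5's `ArchG3Values`) — to the Δ-vanishing at a NEW
node `x₁`, `|x₁| ≤ N′ ≤ 3N + 2`, for one multi-index `(a, μ)` with `a + |μ| + t ≤ T`: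

1. the MIXED values `archφ (pvΔ μ) (a′, σ) x` vanish for `a′ + |σ| ≤ a + t − 1` (change of basis, `archφ_pvΔ_eq_zero_of_invariant`);
2. hence the `f − φ` comparison IS the value envelope at the node (`archF_envelope_of_vanishing`, `Θ = 1`), and the Taylor-normalised
   jets majorant (`norm_iteratedDeriv_archF_le_jetMaj` + `ArchJets.jetMaj_le_scaled`) gives
   `‖(f_{a,μ})^{(σ)}(x)‖ ≤ σ!·(2C)^σ·(2ᵃ e^{y/C} ε_N)` for `σ < t` (`f_{a,μ} = archF (pvΔ μ) (a,0)`, `y = Σ AₖΓₖ`, any `C ≥ 1`);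
3. the growth of `e^{−γz} f_{a,μ}` on the disc `‖z‖ ≤ (3E+1)(2N+1)+N` is `#B·P·W·e^{Emax·ρ}` (`norm_exp_mul_archF_le_of_disc`, `∏Γ^0 = 1`:
   no directional monomials — DESIGN FINDING #2);
4. `ArchKStep.norm_le_of_taylor_jets_symm` (Hermite with free ratio `E`, Taylor jets) bounds `‖f_{a,μ}(x₁)‖`, the comparison at `x₁`
   bounds `|archφ (pvΔ μ) (a,0) x₁|`, and the denominator `den₀·monDen(α, Dbox·|x₁|)` (`exists_int_clear_mul_archφ_zero`, no power of
   `b_{j₀}`) with the numerical inequality `hfinal` forces `archφ (pvΔ μ) (a, 0) x₁ = 0` (`ArchKStep.rat_eq_zero_of_abs_lt`).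

* `archφ_pvΔ_mixed_eq_zero` (step 1), `taylor_jets_archF_pvΔ` (step 2), `kstep_delta_symm` (the k-step, symmetric nodes) and
  `kstep_delta_odd` (odd nodes `|x| ≤ 2m − 1 → |x₁| ≤ N′ ≤ 6m`).

All sizes are the frame's uniform currencies (`P ≥ |pvΔ μ i|`, `W` for the Hasse weights on the disc / at the nodes, `Γₖ ≥ |𝔛ₖ(vᵢ)/b_{j₀}|`,
`Lmax ≥ |Lsum vᵢ|`, `V₀ ≥ |vᵢ,j₀|`, `Emax ≥ |E vᵢ − γ|`, the box `Dbox`, `den₀`); the record (`ArchG3Par`, seat p1) supplies numbers and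
discharges `hfinal` — per k-step the derivative cost is `t·log(2C)` + the one-off `e^{y/C}` (R26(d)).

WHAT THIS IS NOT: not the level-invariant structure and its k-steps (`ArchG3Levels.lean`, next), not the START, half-step or END; no crux moves.

## References
* Yu. V. Nesterenko, LNM 1819 (2003) — §3.5 (3.34) p. 72, §4 (4.6)–(4.7) p. 80–81, §4.1 Lemma 4.2 p. 82–83, §4.2 Lemma 4.3 (4.16)–(4.23)
  p. 83–87, (4.24)–(4.35) p. 87–90. [Nesterenko2003]
* K. Yu, Acta Math. 211 (2013) — Lemma 5.2 (the `p`-adic model `g3_kstep_pm`). [Yu2013]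
-/

noncomputable section

open Finset Polynomial
open Literature.NumberTheory.Transcendental
open Literature.NumberTheory.Transcendental.CW77.Setup (Tau tauNorm)
open Summit.ABC.StewartYu.ArchJets (jetMaj env jetMaj_le_scaled)
open scoped Nat

namespace Summit.ABC.StewartYu

namespace ArchG3Setup

variable (S : ArchG3Setup) {ι : Type*} (R : ι → ℚ[X]) (v : ι → Fin S.n → ℤ)

/-! ### Step 1: the mixed values vanish at an old node -/

/-- **Mixed values from the Δ-invariant** (print (4.21)): if the Δ-values `archφ (pvΔ μ′) (a′, 0) x` vanish for `a′ + |μ′| < T`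
(`c ≠ 0`) and `a + |μ| + t ≤ T`, then `archφ (pvΔ μ) τ′ x = 0` for every `τ′` with `|τ′| ≤ a + t − 1`.
[cite: Nesterenko2003, §4.2 (4.21), p. 85–86] -/
theorem archφ_pvΔ_mixed_eq_zero (B : Finset ι) (pv : ι → ℤ) {c : ℤ} (hc : c ≠ 0) (e : Fin S.n → ℤ) (x : ℤ) {T : ℕ}
    (hinv : ∀ (a' : ℕ) (μ' : Fin S.n → ℕ), a' + ∑ k, μ' k < T → S.archφ R v B (S.pvΔ v pv c e μ') (a', 0) x = 0)
    {a t : ℕ} {μ : Fin S.n → ℕ} (ht : 1 ≤ t) (haμ : a + (∑ k, μ k) + t ≤ T) :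
    ∀ τ' : Tau S.n, tauNorm τ' ≤ a + t - 1 → S.archφ R v B (S.pvΔ v pv c e μ) τ' x = 0 :=
  fun τ' hτ' => S.archφ_pvΔ_eq_zero_of_invariant R v B pv hc e x T hinv μ τ' (by omega)

/-! ### Step 2: the Taylor-normalised jets at an old node -/

/-- `env 1 Γ (a, 0) = 1` and `∏ₖ Γₖ^0 = 1`. [folklore] -/
private theorem env_one_zero (Γ : Fin S.n → ℝ) (a : ℕ) : env 1 Γ ((a, 0) : Tau S.n) = 1 := by
  simp [env]

/-- **Taylor jets of `f_{a,μ} = archF (pvΔ μ) (a, 0)` at an old node `x`** (`|x| ≤ N`): under the Δ-invariant at `x` of order `T`,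
`a + |μ| + t ≤ T`, and the uniform data (`|pvΔ μ i| ≤ P`, `|Hasse_{t₀}Rᵢ(x)| ≤ W` for `t₀ < T`, `|zγ(vᵢ)ₖ| ≤ Γₖ`, `|log αₖ| ≤ Aₖ`,
`|Lsum vᵢ| ≤ Lmax`, `|vᵢ,j₀| ≤ V₀`, `V₀·|Λ/b_{j₀}|·N ≤ 1`), for every `C ≥ 1` and `σ < t`:
`‖(f_{a,μ})^{(σ)}(x)‖ ≤ σ!·((2C)^σ·(2ᵃ·e^{y/C}·ε_N))`, `y = Σₖ AₖΓₖ`, `ε_N = #B·P·W·e^{Lmax·N}·2V₀|Λ/b_{j₀}|N`.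
[cite: Nesterenko2003, §4.2 Lemma 4.3 (4.19)–(4.23), p. 84–87] -/
theorem taylor_jets_archF_pvΔ (B : Finset ι) (pv : ι → ℤ) {c : ℤ} (hc : c ≠ 0) (e : Fin S.n → ℤ) {T : ℕ}
    {a t : ℕ} {μ : Fin S.n → ℕ} (ht : 1 ≤ t) (haμ : a + (∑ k, μ k) + t ≤ T)
    {N : ℕ} (x : ℤ) (hx : |x| ≤ (N : ℤ))
    (hinv : ∀ (a' : ℕ) (μ' : Fin S.n → ℕ), a' + ∑ k, μ' k < T → S.archφ R v B (S.pvΔ v pv c e μ') (a', 0) x = 0)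
    {A : Fin S.n → ℝ} (hA : ∀ k, |S.lg k| ≤ A k)
    {Γ : Fin S.n → ℝ} (hΓ0 : ∀ k, 0 ≤ Γ k) (hΓ : ∀ i ∈ B, ∀ k, |(S.zγ (v i) k : ℝ)| ≤ Γ k)
    {P : ℝ} (hP0 : 0 ≤ P) (hP : ∀ i ∈ B, |(S.pvΔ v pv c e μ i : ℝ)| ≤ P)
    {W : ℝ} (hW0 : 0 ≤ W) (hW : ∀ i ∈ B, ∀ t₀ < T, |(((hasseDeriv t₀ (R i)).eval (x : ℚ) : ℚ) : ℝ)| ≤ W)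
    {Lmax : ℝ} (hL0 : 0 ≤ Lmax) (hL : ∀ i ∈ B, |S.Lsum (v i)| ≤ Lmax)
    {V₀ : ℝ} (hV0 : 0 ≤ V₀) (hV₀ : ∀ i ∈ B, |(v i S.j₀ : ℝ)| ≤ V₀)
    (hsmall : V₀ * |S.Λ / (S.b S.j₀ : ℝ)| * N ≤ 1) {C : ℝ} (hC : 1 ≤ C) :
    ∀ σ, σ < t → ‖iteratedDeriv σ (S.archF R v B (S.pvΔ v pv c e μ) ((a, 0) : Tau S.n)) (x : ℂ)‖ ≤
      σ.factorial * ((2 * C) ^ σ * ((2 : ℝ) ^ a * Real.exp ((∑ k, A k * Γ k) / C) *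
        (B.card * P * W * Real.exp (Lmax * N) * (2 * (V₀ * |S.Λ / (S.b S.j₀ : ℝ)| * N))))) := by
  intro σ hσ
  set pv' := S.pvΔ v pv c e μ with hpv'
  set δ : ℝ := |S.Λ / (S.b S.j₀ : ℝ)| with hδ
  have hδ0 : 0 ≤ δ := abs_nonneg _
  have hxR : |(x : ℝ)| ≤ N := by exact_mod_cast hx
  -- step 1: mixed vanishing up to order `a + t − 1`
  have hvan : ∀ τ' : Tau S.n, tauNorm τ' ≤ a + t - 1 → S.archφ R v B pv' τ' x = 0 :=
    S.archφ_pvΔ_mixed_eq_zero R v B pv hc e x hinv ht haμ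
  -- the envelope at `x` (Θ = 1)
  have hsmallx : V₀ * |S.Λ / (S.b S.j₀ : ℝ)| * |(x : ℝ)| ≤ 1 :=
    le_trans (mul_le_mul_of_nonneg_left hxR (mul_nonneg hV0 hδ0)) hsmall
  have hWx : ∀ i ∈ B, ∀ t₀ ≤ a + t - 1, |(((hasseDeriv t₀ (R i)).eval (x : ℚ) : ℚ) : ℝ)| ≤ W :=
    fun i hi t₀ ht₀ => hW i hi t₀ (by omega)
  set εx : ℝ := B.card * P * W * Real.exp (Lmax * |(x : ℝ)|) * (2 * (V₀ * |S.Λ / (S.b S.j₀ : ℝ)| * |(x : ℝ)|)) with hεx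
  have henv : ∀ τ' : Tau S.n, tauNorm τ' ≤ a + t - 1 → ‖S.archF R v B pv' τ' (x : ℂ)‖ ≤ εx * env 1 Γ τ' :=
    S.archF_envelope_of_vanishing R v B pv' x (a + t - 1) hvan hP hWx hΓ hL hV₀ hsmallx
  -- step 2: the jets majorant at `τ = (a, 0)`
  have hjets := S.norm_iteratedDeriv_archF_le_jetMaj R v B pv' hA zero_le_one hΓ0 (x : ℂ) (a + t - 1) henv σ
    ((a, 0) : Tau S.n) (by simp [tauNorm]; omega)
  rw [env_one_zero] at hjets
  -- bound the majorant: `jetMaj 1 y a σ ≤ 2^{a+σ}·1·C^σ·e^{y/C}`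
  have hy0 : 0 ≤ ∑ k, A k * Γ k := sum_nonneg fun k _ => mul_nonneg ((abs_nonneg _).trans (hA k)) (hΓ0 k)
  have hmaj := jetMaj_le_scaled (Θ := 1) zero_le_one hy0 hC a σ
  rw [max_self, one_pow, mul_one] at hmaj
  -- monotonicity in `|x| ≤ N`
  have hεx0 : 0 ≤ εx := by rw [hεx]; positivity
  have hεxN : εx ≤ B.card * P * W * Real.exp (Lmax * N) * (2 * (V₀ * |S.Λ / (S.b S.j₀ : ℝ)| * N)) := by
    rw [hεx]
    have h1 : Real.exp (Lmax * |(x : ℝ)|) ≤ Real.exp (Lmax * N) :=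
      Real.exp_le_exp.mpr (mul_le_mul_of_nonneg_left hxR hL0)
    have h2 : 2 * (V₀ * |S.Λ / (S.b S.j₀ : ℝ)| * |(x : ℝ)|) ≤ 2 * (V₀ * |S.Λ / (S.b S.j₀ : ℝ)| * N) :=
      mul_le_mul_of_nonneg_left (mul_le_mul_of_nonneg_left hxR (mul_nonneg hV0 hδ0)) (by norm_num)
    exact mul_le_mul (mul_le_mul_of_nonneg_left h1 (by positivity)) h2 (by positivity) (by positivity)
  have hC0 : 0 ≤ C := le_trans zero_le_one hC
  calc ‖iteratedDeriv σ (S.archF R v B pv' ((a, 0) : Tau S.n)) (x : ℂ)‖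
      ≤ (σ ! : ℝ) * (εx * 1) * jetMaj 1 (∑ k, A k * Γ k) a σ := hjets
    _ ≤ (σ ! : ℝ) * (εx * 1) * (2 ^ (a + σ) * C ^ σ * Real.exp ((∑ k, A k * Γ k) / C)) :=
        mul_le_mul_of_nonneg_left hmaj (by positivity)
    _ = σ.factorial * ((2 * C) ^ σ * ((2 : ℝ) ^ a * Real.exp ((∑ k, A k * Γ k) / C) * εx)) := by
        rw [pow_add, mul_pow]; ring
    _ ≤ σ.factorial * ((2 * C) ^ σ * ((2 : ℝ) ^ a * Real.exp ((∑ k, A k * Γ k) / C) *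
          (B.card * P * W * Real.exp (Lmax * N) * (2 * (V₀ * |S.Λ / (S.b S.j₀ : ℝ)| * N))))) := by
        gcongr

/-! ### The k-step in Δ-form, symmetric nodes -/

/-- From `‖F − φ‖ ≤ ε_c` and `‖F‖ ≤ A`: `|φ| ≤ A + ε_c`. [folklore] -/
private theorem abs_ratCast_le_of_norm_sub_le'' {u : ℂ} {q : ℚ} {A εc : ℝ} (hA : ‖u‖ ≤ A)
    (hcmp : ‖u - ((q : ℚ) : ℂ)‖ ≤ εc) : |(q : ℝ)| ≤ A + εc := by
  have h1 : ‖((q : ℚ) : ℂ)‖ ≤ ‖u‖ + ‖u - ((q : ℚ) : ℂ)‖ := by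
    calc ‖((q : ℚ) : ℂ)‖ = ‖u - (u - ((q : ℚ) : ℂ))‖ := by rw [sub_sub_cancel]
      _ ≤ ‖u‖ + ‖u - ((q : ℚ) : ℂ)‖ := norm_sub_le u (u - ((q : ℚ) : ℂ))
  have h2 : ‖((q : ℚ) : ℂ)‖ = |(q : ℝ)| := by
    rw [← Complex.ofReal_ratCast, Complex.norm_real, Real.norm_eq_abs]
  rw [← h2]; linarith

/-- **THE ARCHIMEDEAN k-STEP IN Δ-FORM, symmetric nodes** (twin of `G3Setup.g3_kstep_pm`; Nesterenko's `𝒳_{s,ν} → 𝒳_{s,ν+1}`).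
Setting: class functions of `ArchG3Setup` with Δ-weighted coefficients `pvΔ pv c e ·` (`c ≠ 0`), relative exponents `vᵢ` in the box
`|vᵢⱼ| ≤ Dboxⱼ`, a twist centre `γ ∈ ℝ`, a ratio `E ≥ 1`, a jets scale `C ≥ 1`.  HYPOTHESES: the Δ-invariant of order `T` at the old
nodes `|x| ≤ N`; one multi-index `(a, μ)` with `a + |μ| + t ≤ T` (`t ≥ 1`); a new node `|x₁| ≤ N′ ≤ 3N + 2`; the uniform sizes
(`P ≥ |pvΔ μ i|`; `Wd` for the Hasse weights of `Y₀`-order `a` on the disc `‖z‖ ≤ ρ_E := (3E+1)(2N+1)+N`; `Wn` for the Hasse values of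
orders `< T` at the integers `|x| ≤ 3N+2`; `Γ`, `A`, `Lmax`, `V₀`, `Emax ≥ |E vᵢ − γ|`; `V₀|Λ/b_{j₀}|(3N+2) ≤ 1`); the clearing data
`den₀` of the Hasse values of order `a` at `x₁`; and the numerical inequality
`e^{|γ|N′}·(2(2N+1)^{t+1} t (20e)^{(2N+1)t}·((2C)ᵗ e^{|γ|(N+1)}·2ᵃ e^{y/C} ε_N) + B_G·E^{−(2N+1)t}) + ε_c < 1/(den₀·monDen(α, Dbox|x₁|))`
with `ε_N = #B·P·Wn·e^{Lmax N}·2V₀|Λ/b_{j₀}|N`, `B_G = #B·P·Wd·e^{Emax ρ_E}`, `ε_c = #B·P·Wn·e^{Lmax N′}·2V₀|Λ/b_{j₀}|N′`.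
CONCLUSION: `archφ R v B (pvΔ pv c e μ) (a, 0) x₁ = 0`.
[cite: Nesterenko2003, §4.2 Lemma 4.3 and (4.24)–(4.35), p. 84–90] [cite: Yu2013, Lemma 5.2] -/
theorem kstep_delta_symm (B : Finset ι) (pv : ι → ℤ) {c : ℤ} (hc : c ≠ 0) (e : Fin S.n → ℤ) {T N N' t : ℕ}
    (hN' : N' ≤ 3 * N + 2) (ht : 1 ≤ t)
    (hinv : ∀ x : ℤ, |x| ≤ (N : ℤ) → ∀ (a' : ℕ) (μ' : Fin S.n → ℕ), a' + ∑ k, μ' k < T →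
      S.archφ R v B (S.pvΔ v pv c e μ') (a', 0) x = 0)
    {a : ℕ} {μ : Fin S.n → ℕ} (haμ : a + (∑ k, μ k) + t ≤ T) (x₁ : ℤ) (hx₁ : |x₁| ≤ (N' : ℤ))
    -- uniform sizes
    {A : Fin S.n → ℝ} (hA : ∀ k, |S.lg k| ≤ A k)
    {Γ : Fin S.n → ℝ} (hΓ0 : ∀ k, 0 ≤ Γ k) (hΓ : ∀ i ∈ B, ∀ k, |(S.zγ (v i) k : ℝ)| ≤ Γ k)
    {P : ℝ} (hP0 : 0 ≤ P) (hP : ∀ i ∈ B, |(S.pvΔ v pv c e μ i : ℝ)| ≤ P)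
    {E : ℝ} (hE : 1 ≤ E) (γ : ℝ)
    {Wd : ℝ} (hWd : ∀ i ∈ B, ∀ z : ℂ, ‖z‖ ≤ (3 * E + 1) * (2 * N + 1) + N → ‖(hw R i a).eval z‖ ≤ Wd)
    {Wn : ℝ} (hWn0 : 0 ≤ Wn)
    (hWn : ∀ i ∈ B, ∀ t₀ < T, ∀ x : ℤ, |x| ≤ 3 * (N : ℤ) + 2 → |(((hasseDeriv t₀ (R i)).eval (x : ℚ) : ℚ) : ℝ)| ≤ Wn)
    {Lmax : ℝ} (hL0 : 0 ≤ Lmax) (hL : ∀ i ∈ B, |S.Lsum (v i)| ≤ Lmax)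
    {V₀ : ℝ} (hV0 : 0 ≤ V₀) (hV₀ : ∀ i ∈ B, |(v i S.j₀ : ℝ)| ≤ V₀)
    (hsmall : V₀ * |S.Λ / (S.b S.j₀ : ℝ)| * (3 * N + 2) ≤ 1)
    {Emax : ℝ} (hEm : ∀ i ∈ B, |S.E (v i) - γ| ≤ Emax) {C : ℝ} (hC : 1 ≤ C)
    -- denominators
    {Dbox : Fin S.n → ℕ} (hv : ∀ i ∈ B, ∀ j, |v i j| ≤ (Dbox j : ℤ))
    {den₀ : ℕ} (hden₀ : 1 ≤ den₀) (hR : ∀ i ∈ B, ∃ z₀ : ℤ, (den₀ : ℚ) * (hasseDeriv a (R i)).eval (x₁ : ℚ) = z₀)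
    -- the numerical inequality
    (hfinal : Real.exp (|γ| * N') *
        (2 * ((2 * N + 1 : ℕ) : ℝ) ^ (t + 1) * t * (20 * Real.exp 1) ^ ((2 * N + 1) * t) *
            ((2 * C) ^ t * Real.exp (|γ| * (N + 1)) *
              ((2 : ℝ) ^ a * Real.exp ((∑ k, A k * Γ k) / C) *
                (B.card * P * Wn * Real.exp (Lmax * N) * (2 * (V₀ * |S.Λ / (S.b S.j₀ : ℝ)| * N))))) +
          B.card * P * Wd * Real.exp (Emax * ((3 * E + 1) * (2 * N + 1) + N)) * (1 / E) ^ ((2 * N + 1) * t)) +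
        B.card * P * Wn * Real.exp (Lmax * N') * (2 * (V₀ * |S.Λ / (S.b S.j₀ : ℝ)| * N')) <
      1 / ((den₀ * MonomialDen.monDen S.α (fun j => Dbox j * x₁.natAbs) : ℕ) : ℝ)) :
    S.archφ R v B (S.pvΔ v pv c e μ) (a, 0) x₁ = 0 := by
  set pv' := S.pvΔ v pv c e μ with hpv'
  set f : ℂ → ℂ := S.archF R v B pv' ((a, 0) : Tau S.n) with hf
  set δ : ℝ := |S.Λ / (S.b S.j₀ : ℝ)| with hδ
  have hδ0 : 0 ≤ δ := abs_nonneg _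
  have hN0 : (0 : ℝ) ≤ N := Nat.cast_nonneg _
  have haT : a < T := by omega
  -- (2) Taylor jets at the old nodes
  have hsmallN : V₀ * |S.Λ / (S.b S.j₀ : ℝ)| * N ≤ 1 :=
    le_trans (mul_le_mul_of_nonneg_left (by linarith) (mul_nonneg hV0 hδ0)) hsmall
  have hjet : ∀ x : ℤ, |x| ≤ (N : ℤ) → ∀ σ, σ < t → ‖iteratedDeriv σ f (x : ℂ)‖ ≤
      σ.factorial * ((2 * C) ^ σ * ((2 : ℝ) ^ a * Real.exp ((∑ k, A k * Γ k) / C) *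
        (B.card * P * Wn * Real.exp (Lmax * N) * (2 * (V₀ * |S.Λ / (S.b S.j₀ : ℝ)| * N))))) := by
    intro x hx
    exact S.taylor_jets_archF_pvΔ R v B pv hc e ht haμ x hx (hinv x hx) hA hΓ0 hΓ hP0 hP hWn0
      (fun i hi t₀ ht₀ => hWn i hi t₀ ht₀ x (by omega)) hL0 hL hV0 hV₀ hsmallN hC
  -- (3) growth of the twisted function on the big disc (`∏Γ^0 = 1`)
  have hBG : ∀ z : ℂ, ‖z‖ ≤ (3 * E + 1) * (2 * N + 1) + N →
      ‖Complex.exp (-(γ : ℂ) * z) * f z‖ ≤ B.card * P * Wd * Real.exp (Emax * ((3 * E + 1) * (2 * N + 1) + N)) := by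
    intro z hz
    have h := S.norm_exp_mul_archF_le_of_disc R v γ B pv' ((a, 0) : Tau S.n) hz hP (fun i hi => hWd i hi z hz) hΓ hEm
    simpa using h
  -- (4a) Hermite at `x₁`
  have hx₁n : ‖((x₁ : ℤ) : ℂ)‖ ≤ 3 * N + 2 := by
    rw [Complex.norm_intCast]
    have : (|x₁| : ℝ) ≤ N' := by exact_mod_cast hx₁
    have : ((N' : ℕ) : ℝ) ≤ 3 * N + 2 := by exact_mod_cast hN'
    linarith
  have h2C : 1 ≤ 2 * C := by linarith
  have hε0 : 0 ≤ (2 : ℝ) ^ a * Real.exp ((∑ k, A k * Γ k) / C) *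
      (B.card * P * Wn * Real.exp (Lmax * N) * (2 * (V₀ * |S.Λ / (S.b S.j₀ : ℝ)| * N))) := by positivity
  have hF := ArchKStep.norm_le_of_taylor_jets_symm (S.differentiable_archF R v B pv' (a, 0)) (-(γ : ℂ)) N ht h2C hε0 hE
    hjet hBG hx₁n
  have hγ : ‖-(γ : ℂ)‖ = |γ| := by rw [norm_neg, Complex.norm_real, Real.norm_eq_abs]
  rw [hγ] at hF
  -- the value bound with `e^{|γ| N'}`
  set Aval : ℝ := 2 * ((2 * N + 1 : ℕ) : ℝ) ^ (t + 1) * t * (20 * Real.exp 1) ^ ((2 * N + 1) * t) *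
      ((2 * C) ^ t * Real.exp (|γ| * (N + 1)) *
        ((2 : ℝ) ^ a * Real.exp ((∑ k, A k * Γ k) / C) *
          (B.card * P * Wn * Real.exp (Lmax * N) * (2 * (V₀ * |S.Λ / (S.b S.j₀ : ℝ)| * N))))) +
    B.card * P * Wd * Real.exp (Emax * ((3 * E + 1) * (2 * N + 1) + N)) * (1 / E) ^ ((2 * N + 1) * t) with hAval
  have hWd0 : 0 ≤ B.card * P * Wd * Real.exp (Emax * ((3 * E + 1) * (2 * N + 1) + N)) :=
    le_trans (norm_nonneg _) (hBG 0 (by simp; positivity))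
  have hAval0 : 0 ≤ Aval := by rw [hAval]; positivity
  have hexp : Real.exp (|γ| * ‖((x₁ : ℤ) : ℂ)‖) ≤ Real.exp (|γ| * N') := by
    refine Real.exp_le_exp.mpr (mul_le_mul_of_nonneg_left ?_ (abs_nonneg _))
    rw [Complex.norm_intCast]; exact_mod_cast hx₁
  have hF' : ‖f ((x₁ : ℤ) : ℂ)‖ ≤ Real.exp (|γ| * N') * Aval := hF.trans (mul_le_mul_of_nonneg_right hexp hAval0)
  -- (4b) the comparison at `x₁`
  have hx₁R : |(x₁ : ℝ)| ≤ N' := by exact_mod_cast hx₁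
  have hN'R : ((N' : ℕ) : ℝ) ≤ 3 * N + 2 := by exact_mod_cast hN'
  have hsmall₁ : V₀ * |S.Λ / (S.b S.j₀ : ℝ)| * |(x₁ : ℝ)| ≤ 1 :=
    le_trans (mul_le_mul_of_nonneg_left (hx₁R.trans hN'R) (mul_nonneg hV0 hδ0)) hsmall
  have hcmp0 := S.norm_archF_sub_archφ_le_intCast R v B pv' ((a, 0) : Tau S.n) x₁ hP
    (fun i hi => hWn i hi a haT x₁ (by omega)) hΓ hL hV₀ hsmall₁
  have hcmp : ‖f ((x₁ : ℤ) : ℂ) - ((S.archφ R v B pv' ((a, 0) : Tau S.n) x₁ : ℚ) : ℂ)‖ ≤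
      B.card * P * Wn * Real.exp (Lmax * N') * (2 * (V₀ * |S.Λ / (S.b S.j₀ : ℝ)| * N')) := by
    refine hcmp0.trans ?_
    simp only [Finset.prod_const_one, Pi.zero_apply, pow_zero, mul_one]
    have h1 : Real.exp (Lmax * |(x₁ : ℝ)|) ≤ Real.exp (Lmax * N') :=
      Real.exp_le_exp.mpr (mul_le_mul_of_nonneg_left hx₁R hL0)
    have h2 : 2 * (V₀ * |S.Λ / (S.b S.j₀ : ℝ)| * |(x₁ : ℝ)|) ≤ 2 * (V₀ * |S.Λ / (S.b S.j₀ : ℝ)| * N') :=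
      mul_le_mul_of_nonneg_left (mul_le_mul_of_nonneg_left hx₁R (mul_nonneg hV0 hδ0)) (by norm_num)
    exact mul_le_mul (mul_le_mul_of_nonneg_left h1 (by positivity)) h2 (by positivity) (by positivity)
  have hφ : |((S.archφ R v B pv' ((a, 0) : Tau S.n) x₁ : ℚ) : ℝ)| ≤
      Real.exp (|γ| * N') * Aval + B.card * P * Wn * Real.exp (Lmax * N') * (2 * (V₀ * |S.Λ / (S.b S.j₀ : ℝ)| * N')) :=
    abs_ratCast_le_of_norm_sub_le'' hF' hcmp
  -- (4c) the denominator and the Liouville conclusion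
  have hmon := MonomialDen.one_le_monDen S.α S.α_ne (fun j => Dbox j * x₁.natAbs)
  have hD1 : 1 ≤ den₀ * MonomialDen.monDen S.α (fun j => Dbox j * x₁.natAbs) := one_le_mul hden₀ hmon
  have hden := S.exists_int_clear_mul_archφ_zero R v B pv' hv a x₁ hR
  exact ArchKStep.rat_eq_zero_of_abs_lt hD1 hden (lt_of_le_of_lt hφ (by rw [hAval]; exact hfinal))

/-! ### The k-step in Δ-form, odd nodes (the first k-step of a level) -/

/-- **THE ARCHIMEDEAN k-STEP IN Δ-FORM, odd nodes** (twin of `G3Setup.g3_kstep_pm_oddNodes`; Nesterenko's `𝒳_{s,0} → 𝒳_{s,1}`):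
as `kstep_delta_symm` with the Δ-invariant at the ODD nodes `|x| ≤ 2m − 1` (`m ≥ 1`), the new node `|x₁| ≤ N′ ≤ 6m`, the disc
`‖z‖ ≤ (12E+6)m`, Hasse values at `|x| ≤ 6m`, `V₀|Λ/b_{j₀}|·6m ≤ 1`, and the inequality with the odd-node constants
(`2(2m)^{t+1} t (20e)^{2mt}·2ᵗ·((2C)ᵗ e^{2m|γ|}·2ᵃ e^{y/C} ε_{2m−1}) + B_G E^{−2mt}`).
[cite: Nesterenko2003, §4.2 Lemma 4.3 with the nodes 𝒳_{s,0}, (4.24)–(4.35), p. 84–90] [cite: Yu2013, Lemma 5.2] -/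
theorem kstep_delta_odd (B : Finset ι) (pv : ι → ℤ) {c : ℤ} (hc : c ≠ 0) (e : Fin S.n → ℤ) {T m N' t : ℕ}
    (hm : 1 ≤ m) (hN' : N' ≤ 6 * m) (ht : 1 ≤ t)
    (hinv : ∀ x : ℤ, Odd x → |x| ≤ 2 * (m : ℤ) - 1 → ∀ (a' : ℕ) (μ' : Fin S.n → ℕ), a' + ∑ k, μ' k < T →
      S.archφ R v B (S.pvΔ v pv c e μ') (a', 0) x = 0)
    {a : ℕ} {μ : Fin S.n → ℕ} (haμ : a + (∑ k, μ k) + t ≤ T) (x₁ : ℤ) (hx₁ : |x₁| ≤ (N' : ℤ))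
    -- uniform sizes
    {A : Fin S.n → ℝ} (hA : ∀ k, |S.lg k| ≤ A k)
    {Γ : Fin S.n → ℝ} (hΓ0 : ∀ k, 0 ≤ Γ k) (hΓ : ∀ i ∈ B, ∀ k, |(S.zγ (v i) k : ℝ)| ≤ Γ k)
    {P : ℝ} (hP0 : 0 ≤ P) (hP : ∀ i ∈ B, |(S.pvΔ v pv c e μ i : ℝ)| ≤ P)
    {E : ℝ} (hE : 1 ≤ E) (γ : ℝ)
    {Wd : ℝ} (hWd : ∀ i ∈ B, ∀ z : ℂ, ‖z‖ ≤ (12 * E + 6) * m → ‖(hw R i a).eval z‖ ≤ Wd)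
    {Wn : ℝ} (hWn0 : 0 ≤ Wn)
    (hWn : ∀ i ∈ B, ∀ t₀ < T, ∀ x : ℤ, |x| ≤ 6 * (m : ℤ) → |(((hasseDeriv t₀ (R i)).eval (x : ℚ) : ℚ) : ℝ)| ≤ Wn)
    {Lmax : ℝ} (hL0 : 0 ≤ Lmax) (hL : ∀ i ∈ B, |S.Lsum (v i)| ≤ Lmax)
    {V₀ : ℝ} (hV0 : 0 ≤ V₀) (hV₀ : ∀ i ∈ B, |(v i S.j₀ : ℝ)| ≤ V₀)
    (hsmall : V₀ * |S.Λ / (S.b S.j₀ : ℝ)| * (6 * m) ≤ 1)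
    {Emax : ℝ} (hEm : ∀ i ∈ B, |S.E (v i) - γ| ≤ Emax) {C : ℝ} (hC : 1 ≤ C)
    -- denominators
    {Dbox : Fin S.n → ℕ} (hv : ∀ i ∈ B, ∀ j, |v i j| ≤ (Dbox j : ℤ))
    {den₀ : ℕ} (hden₀ : 1 ≤ den₀) (hR : ∀ i ∈ B, ∃ z₀ : ℤ, (den₀ : ℚ) * (hasseDeriv a (R i)).eval (x₁ : ℚ) = z₀)
    -- the numerical inequality
    (hfinal : Real.exp (|γ| * N') *
        (2 * ((2 * m : ℕ) : ℝ) ^ (t + 1) * t * (20 * Real.exp 1) ^ ((2 * m) * t) *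
            (2 ^ t * ((2 * C) ^ t * Real.exp (|γ| * (2 * m)) *
              ((2 : ℝ) ^ a * Real.exp ((∑ k, A k * Γ k) / C) *
                (B.card * P * Wn * Real.exp (Lmax * ((2 * m - 1 : ℕ) : ℝ)) *
                  (2 * (V₀ * |S.Λ / (S.b S.j₀ : ℝ)| * ((2 * m - 1 : ℕ) : ℝ))))))) +
          B.card * P * Wd * Real.exp (Emax * ((12 * E + 6) * m)) * (1 / E) ^ ((2 * m) * t)) +
        B.card * P * Wn * Real.exp (Lmax * N') * (2 * (V₀ * |S.Λ / (S.b S.j₀ : ℝ)| * N')) <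
      1 / ((den₀ * MonomialDen.monDen S.α (fun j => Dbox j * x₁.natAbs) : ℕ) : ℝ)) :
    S.archφ R v B (S.pvΔ v pv c e μ) (a, 0) x₁ = 0 := by
  set pv' := S.pvΔ v pv c e μ with hpv'
  set f : ℂ → ℂ := S.archF R v B pv' ((a, 0) : Tau S.n) with hf
  set δ : ℝ := |S.Λ / (S.b S.j₀ : ℝ)| with hδ
  have hδ0 : 0 ≤ δ := abs_nonneg _
  have hm0 : (1 : ℝ) ≤ m := by exact_mod_cast hm
  have haT : a < T := by omega
  set Nold : ℕ := 2 * m - 1 with hNold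
  have hNoldZ : ((Nold : ℕ) : ℤ) = 2 * (m : ℤ) - 1 := by rw [hNold]; omega
  have hNoldR : ((Nold : ℕ) : ℝ) ≤ 6 * m := by
    have : ((Nold : ℕ) : ℝ) = 2 * m - 1 := by exact_mod_cast (by rw [hNold]; omega : ((Nold : ℕ) : ℤ) = 2 * (m : ℤ) - 1)
    rw [this]; linarith
  -- (2) Taylor jets at the old (odd) nodes
  have hsmallN : V₀ * |S.Λ / (S.b S.j₀ : ℝ)| * Nold ≤ 1 :=
    le_trans (mul_le_mul_of_nonneg_left hNoldR (mul_nonneg hV0 hδ0)) hsmall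
  have hjet : ∀ x : ℤ, Odd x → |x| ≤ 2 * (m : ℤ) - 1 → ∀ σ, σ < t → ‖iteratedDeriv σ f (x : ℂ)‖ ≤
      σ.factorial * ((2 * C) ^ σ * ((2 : ℝ) ^ a * Real.exp ((∑ k, A k * Γ k) / C) *
        (B.card * P * Wn * Real.exp (Lmax * Nold) * (2 * (V₀ * |S.Λ / (S.b S.j₀ : ℝ)| * Nold))))) := by
    intro x hxo hx
    have hx' : |x| ≤ ((Nold : ℕ) : ℤ) := by rw [hNoldZ]; exact hx
    exact S.taylor_jets_archF_pvΔ R v B pv hc e ht haμ x hx' (hinv x hxo hx) hA hΓ0 hΓ hP0 hP hWn0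
      (fun i hi t₀ ht₀ => hWn i hi t₀ ht₀ x (by omega)) hL0 hL hV0 hV₀ hsmallN hC
  -- (3) growth of the twisted function on the big disc (`∏Γ^0 = 1`)
  have hBG : ∀ z : ℂ, ‖z‖ ≤ (12 * E + 6) * m →
      ‖Complex.exp (-(γ : ℂ) * z) * f z‖ ≤ B.card * P * Wd * Real.exp (Emax * ((12 * E + 6) * m)) := by
    intro z hz
    have h := S.norm_exp_mul_archF_le_of_disc R v γ B pv' ((a, 0) : Tau S.n) hz hP (fun i hi => hWd i hi z hz) hΓ hEm
    simpa using h
  -- (4a) Hermite at `x₁`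
  have hx₁n : ‖((x₁ : ℤ) : ℂ)‖ ≤ 6 * m := by
    rw [Complex.norm_intCast]
    have : (|x₁| : ℝ) ≤ N' := by exact_mod_cast hx₁
    have : ((N' : ℕ) : ℝ) ≤ 6 * m := by exact_mod_cast hN'
    linarith
  have h2C : 1 ≤ 2 * C := by linarith
  have hε0 : 0 ≤ (2 : ℝ) ^ a * Real.exp ((∑ k, A k * Γ k) / C) *
      (B.card * P * Wn * Real.exp (Lmax * Nold) * (2 * (V₀ * |S.Λ / (S.b S.j₀ : ℝ)| * Nold))) := by positivity
  have hF := ArchKStep.norm_le_of_taylor_jets_odd (S.differentiable_archF R v B pv' (a, 0)) (-(γ : ℂ)) hm ht h2C hε0 hE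
    hjet hBG hx₁n
  have hγ : ‖-(γ : ℂ)‖ = |γ| := by rw [norm_neg, Complex.norm_real, Real.norm_eq_abs]
  rw [hγ] at hF
  set Aval : ℝ := 2 * ((2 * m : ℕ) : ℝ) ^ (t + 1) * t * (20 * Real.exp 1) ^ ((2 * m) * t) *
      (2 ^ t * ((2 * C) ^ t * Real.exp (|γ| * (2 * m)) *
        ((2 : ℝ) ^ a * Real.exp ((∑ k, A k * Γ k) / C) *
          (B.card * P * Wn * Real.exp (Lmax * Nold) * (2 * (V₀ * |S.Λ / (S.b S.j₀ : ℝ)| * Nold)))))) +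
    B.card * P * Wd * Real.exp (Emax * ((12 * E + 6) * m)) * (1 / E) ^ ((2 * m) * t) with hAval
  have hWd0 : 0 ≤ B.card * P * Wd * Real.exp (Emax * ((12 * E + 6) * m)) :=
    le_trans (norm_nonneg _) (hBG 0 (by simp; positivity))
  have hAval0 : 0 ≤ Aval := by rw [hAval]; positivity
  have hexp : Real.exp (|γ| * ‖((x₁ : ℤ) : ℂ)‖) ≤ Real.exp (|γ| * N') := by
    refine Real.exp_le_exp.mpr (mul_le_mul_of_nonneg_left ?_ (abs_nonneg _))
    rw [Complex.norm_intCast]; exact_mod_cast hx₁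
  have hF' : ‖f ((x₁ : ℤ) : ℂ)‖ ≤ Real.exp (|γ| * N') * Aval := hF.trans (mul_le_mul_of_nonneg_right hexp hAval0)
  -- (4b) the comparison at `x₁`
  have hx₁R : |(x₁ : ℝ)| ≤ N' := by exact_mod_cast hx₁
  have hN'R : ((N' : ℕ) : ℝ) ≤ 6 * m := by exact_mod_cast hN'
  have hsmall₁ : V₀ * |S.Λ / (S.b S.j₀ : ℝ)| * |(x₁ : ℝ)| ≤ 1 :=
    le_trans (mul_le_mul_of_nonneg_left (hx₁R.trans hN'R) (mul_nonneg hV0 hδ0)) hsmall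
  have hcmp0 := S.norm_archF_sub_archφ_le_intCast R v B pv' ((a, 0) : Tau S.n) x₁ hP
    (fun i hi => hWn i hi a haT x₁ (by omega)) hΓ hL hV₀ hsmall₁
  have hcmp : ‖f ((x₁ : ℤ) : ℂ) - ((S.archφ R v B pv' ((a, 0) : Tau S.n) x₁ : ℚ) : ℂ)‖ ≤
      B.card * P * Wn * Real.exp (Lmax * N') * (2 * (V₀ * |S.Λ / (S.b S.j₀ : ℝ)| * N')) := by
    refine hcmp0.trans ?_
    simp only [Finset.prod_const_one, Pi.zero_apply, pow_zero, mul_one]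
    have h1 : Real.exp (Lmax * |(x₁ : ℝ)|) ≤ Real.exp (Lmax * N') :=
      Real.exp_le_exp.mpr (mul_le_mul_of_nonneg_left hx₁R hL0)
    have h2 : 2 * (V₀ * |S.Λ / (S.b S.j₀ : ℝ)| * |(x₁ : ℝ)|) ≤ 2 * (V₀ * |S.Λ / (S.b S.j₀ : ℝ)| * N') :=
      mul_le_mul_of_nonneg_left (mul_le_mul_of_nonneg_left hx₁R (mul_nonneg hV0 hδ0)) (by norm_num)
    exact mul_le_mul (mul_le_mul_of_nonneg_left h1 (by positivity)) h2 (by positivity) (by positivity)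
  have hφ : |((S.archφ R v B pv' ((a, 0) : Tau S.n) x₁ : ℚ) : ℝ)| ≤
      Real.exp (|γ| * N') * Aval + B.card * P * Wn * Real.exp (Lmax * N') * (2 * (V₀ * |S.Λ / (S.b S.j₀ : ℝ)| * N')) :=
    abs_ratCast_le_of_norm_sub_le'' hF' hcmp
  -- (4c) the denominator and the Liouville conclusion
  have hmon := MonomialDen.one_le_monDen S.α S.α_ne (fun j => Dbox j * x₁.natAbs)
  have hD1 : 1 ≤ den₀ * MonomialDen.monDen S.α (fun j => Dbox j * x₁.natAbs) := one_le_mul hden₀ hmon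
  have hden := S.exists_int_clear_mul_archφ_zero R v B pv' hv a x₁ hR
  exact ArchKStep.rat_eq_zero_of_abs_lt hD1 hden (lt_of_le_of_lt hφ (by rw [hAval]; exact hfinal))

end ArchG3Setup

end Summit.ABC.StewartYu

end
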